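import Summits.ValiantsHypothesis.ValiantsHypothesis.Theorems.DefinabilityGapBlockExclusion
import HarnessLib

/-!
# DefinabilityGap — MATCHING SQUARE, stage H4a: a maximum `T`-free permutation and its square

Route `route-ValiantsHypothesis-DefinabilityGap` (DRAFT), read-once leaf F4 / W10 (aside `KIPlantedHittingRO`,
stmt-ValiantsHypothesis-23704), leaf `ZperHits₂(m)`; census cell W10.rung_ladder.next ‖ v38 «branch (C)
(avoid T = ∅): max-matching top form (H4)» (decomp-valiant bus, OFFER O-L5-MM; file H4a of the series
H4a / H4b / H4c; continues H1a `DefinabilityGapAdmissibleBlocks` and H1b `DefinabilityGapBlockExclusion`).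

**THIS FILE** (pure combinatorics of a cell set `T ⊆ m × m`; no permanents, no chains). Stage H3
(`DefinabilityGapBlockRigidity`) bounds the non-unit support `T` of a void quadratically only when SOME
permutation avoids `T`; when none does, it only produces a rectangle of `T`. Here we prepare the unconditional
version: instead of a `T`-avoiding permutation we take a permutation `σ₀` with the MAXIMUM NUMBER OF `T`-FREE
CELLS (`free`, `exists_max_free`) and the set `D` of its free columns — a maximum matching of the bipartite
complement of `T` (term rank, König / Dulmage–Mendelsohn) — and work on the SQUARE `σ₀(D) × D`.
* MAXIMALITY (`mem_of_not_mem`, `strip_or`, `mul_card_compl_le`): the cells outside the matched rows and columns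
  lie in `T` (else one transposition frees a further column), and every matched cell `(σ₀ i, i)` has its whole ROW
  STRIP `{σ₀ i} × Dᶜ` or its whole COLUMN STRIP `σ₀(Dᶜ) × {i}` in `T` (else a 3-cycle frees a further column:
  no augmenting path of length three); whence the injection `(i', j) ↦ (σ₀ i', j)` (row-strip rows) /
  `(σ₀ j, i')` (other rows) of `univ × Dᶜ` into the cells of `T` OUTSIDE the square: `m · |Dᶜ| ≤ |T ∖ square|`.
* THE AUXILIARY PATTERN `T♯` (`sharp`): `T` on the columns of `D` and every off-`σ₀` cell on the other columns;
  its avoiding permutations are exactly the permutations `T`-free on `D` and equal to `σ₀` off `D`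
  (`mem_avoid_sharp`), among them `σ₀` — so the block machinery of H1a/H1b applies to `T♯` with a base
  permutation even when NO permutation avoids `T`.
* THE COUNT ON THE SQUARE (`sq_le_of_card_rowBlock_le`): if every block of `T♯` through a square row has at
  most `c` rows, `|D|² ≤ 2·|T ∩ square| + c·|D|` (H1b's two injections of the unlinked pairs, restricted to
  `D × D`; the charged cell has its column in `D`, so it is a cell of `T`); with maximality,
  `m² ≤ 2·|T| + c·|D|` (`sq_le_of_maxFree`).

HONEST PLACEMENT. KNOWN mathematics: maximum matchings / term rank and the König theorem
[cite: BrualdiRyser1991, Thm. 1.2.1], the zero blocks of the term-rank normal form of Dulmage–Mendelsohn and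
Brualdi [cite: BrualdiRyser1991, Thm. 4.2.1] (our (M1)/(M2) are its weak «strip» form, proved directly by
exchanging along paths of length one and three), the block structure of a pattern with a base permutation
(H1a/H1b, [cite: BrualdiRyser1991, Thm. 4.2.6, 4.2.7]). Kernel-new bookkeeping only; closes NO item;
0 S-currency; rung 0; VP ≠ VNP untouched. No facts, no Prop-valued definitions, no placeholders; three data
definitions (`free`, `stripCell`, `sharp`).
-/

set_option linter.dupNamespace false

open Finset
open Summit.ValiantsHypothesis.ValiantsHypothesis.Theorems.DefinabilityGapZeroPatternPermanent
open Summit.ValiantsHypothesis.ValiantsHypothesis.Theorems.DefinabilityGapAdmissibleBlocks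
open Summit.ValiantsHypothesis.ValiantsHypothesis.Theorems.DefinabilityGapBlockExclusion

namespace Summit.ValiantsHypothesis.ValiantsHypothesis.Theorems.DefinabilityGapMatchingSquare

noncomputable section

variable {m : ℕ}

/-! ## 1. Free columns of a permutation; a maximum one -/

/-- The FREE COLUMNS of `σ` with respect to `T`: the columns `i` whose `σ`-cell `(σ i, i)` lies off `T`
(a partial matching of the bipartite complement of `T`). [cite: BrualdiRyser1991, Thm. 1.2.1] -/
def free (T : Finset (Fin m × Fin m)) (σ : Equiv.Perm (Fin m)) : Finset (Fin m) :=
  univ.filter fun i => (σ i, i) ∉ T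

/-- Membership in the free columns. [this file] -/
theorem mem_free {T : Finset (Fin m × Fin m)} {σ : Equiv.Perm (Fin m)} {i : Fin m} :
    i ∈ free T σ ↔ (σ i, i) ∉ T := by
  simp only [free, mem_filter, mem_univ, true_and]

/-- A permutation with the MAXIMUM number of `T`-free cells exists (a maximum matching of the complement of `T`,
completed to a permutation). [cite: BrualdiRyser1991, Thm. 1.2.1] -/
theorem exists_max_free (T : Finset (Fin m × Fin m)) :
    ∃ σ₀ : Equiv.Perm (Fin m), ∀ σ : Equiv.Perm (Fin m), (free T σ).card ≤ (free T σ₀).card := by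
  obtain ⟨σ₀, -, h⟩ := exists_max_image (univ : Finset (Equiv.Perm (Fin m)))
    (fun σ => (free T σ).card) ⟨1, mem_univ _⟩
  exact ⟨σ₀, fun σ => h σ (mem_univ σ)⟩

/-! ## 2. Maximality: the outside cells, the strips, the outside count -/

variable {T : Finset (Fin m × Fin m)} {σ₀ : Equiv.Perm (Fin m)} {D : Finset (Fin m)}

/-- Maximality in counting form: no permutation is `T`-free on `D` and on one further column. [this file] -/
theorem false_of_insert_subset_free (hmax : ∀ σ : Equiv.Perm (Fin m), (free T σ).card ≤ D.card)
    {σ : Equiv.Perm (Fin m)} {j : Fin m} (hj : j ∉ D) (h : insert j D ⊆ free T σ) : False := by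
  have h1 := card_le_card h
  rw [card_insert_of_notMem hj] at h1
  have h2 := hmax σ
  omega

/-- MAXIMALITY (M1): the cells outside the matched rows `σ₀(D)` and outside the matched columns `D` lie in `T`
(else the transposition `σ₀ · (j i')` is free on `D` and on `j`). [cite: BrualdiRyser1991, Thm. 4.2.1] -/
theorem mem_of_not_mem (hfree : ∀ i ∈ D, (σ₀ i, i) ∉ T)
    (hmax : ∀ σ : Equiv.Perm (Fin m), (free T σ).card ≤ D.card) {i' j : Fin m} (hi' : i' ∉ D)
    (hj : j ∉ D) : (σ₀ i', j) ∈ T := by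
  by_contra hT
  refine false_of_insert_subset_free hmax (σ := σ₀ * Equiv.swap j i') hj fun k hk => ?_
  rw [mem_free, Equiv.Perm.mul_apply]
  rcases mem_insert.1 hk with rfl | hk
  · rwa [Equiv.swap_apply_left]
  · rw [Equiv.swap_apply_of_ne_of_ne (ne_of_mem_of_not_mem hk hj) (ne_of_mem_of_not_mem hk hi')]
    exact hfree k hk

/-- MAXIMALITY (M2) — no augmenting path of length three: a matched cell `(σ₀ i, i)` has its ROW STRIP
`{σ₀ i} × Dᶜ` or its COLUMN STRIP `σ₀(Dᶜ) × {i}` inside `T` (else, with `(σ₀ i, j) ∉ T` and `(σ₀ i', i) ∉ T`,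
the permutation `σ₀ · (j i') · (i j)` is free on `D` and on `j`). [cite: BrualdiRyser1991, Thm. 4.2.1] -/
theorem strip_or (hfree : ∀ i ∈ D, (σ₀ i, i) ∉ T)
    (hmax : ∀ σ : Equiv.Perm (Fin m), (free T σ).card ≤ D.card) {i : Fin m} (hi : i ∈ D) :
    (∀ j ∈ Dᶜ, (σ₀ i, j) ∈ T) ∨ ∀ i' ∈ Dᶜ, (σ₀ i', i) ∈ T := by
  by_contra! h
  obtain ⟨⟨j, hj, hjT⟩, i', hi', hi'T⟩ := h
  rw [mem_compl] at hj hi'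
  have hij : i ≠ j := fun e => hj (e ▸ hi)
  have hii' : i ≠ i' := fun e => hi' (e ▸ hi)
  refine false_of_insert_subset_free hmax (σ := σ₀ * (Equiv.swap j i' * Equiv.swap i j)) hj
    fun k hk => ?_
  rw [mem_free, Equiv.Perm.mul_apply, Equiv.Perm.mul_apply]
  rcases mem_insert.1 hk with rfl | hk
  · rw [Equiv.swap_apply_right, Equiv.swap_apply_of_ne_of_ne hij hii']
    exact hjT
  · by_cases hki : k = i
    · rw [hki, Equiv.swap_apply_left, Equiv.swap_apply_left]
      exact hi'T
    · rw [Equiv.swap_apply_of_ne_of_ne hki (ne_of_mem_of_not_mem hk hj),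
        Equiv.swap_apply_of_ne_of_ne (ne_of_mem_of_not_mem hk hj) (ne_of_mem_of_not_mem hk hi')]
      exact hfree k hk

/-- The WITNESS CELL of an outside column pair `(i', j)` (`j ∉ D`): the cell `(σ₀ i', j)` of the row strip of
`σ₀ i'` when that strip lies in `T`, else the cell `(σ₀ j, i')` of the column strip of `i'`. [this file] -/
def stripCell (T : Finset (Fin m × Fin m)) (σ₀ : Equiv.Perm (Fin m)) (D : Finset (Fin m))
    (p : Fin m × Fin m) : Fin m × Fin m :=
  if ∀ j ∈ Dᶜ, (σ₀ p.1, j) ∈ T then (σ₀ p.1, p.2) else (σ₀ p.2, p.1)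

/-- The witness cell on a row-strip row. [this file] -/
theorem stripCell_of_pos {p : Fin m × Fin m} (h : ∀ j ∈ Dᶜ, (σ₀ p.1, j) ∈ T) :
    stripCell T σ₀ D p = (σ₀ p.1, p.2) := by
  rw [stripCell, if_pos h]

/-- The witness cell on a column-strip row. [this file] -/
theorem stripCell_of_neg {p : Fin m × Fin m} (h : ¬ ∀ j ∈ Dᶜ, (σ₀ p.1, j) ∈ T) :
    stripCell T σ₀ D p = (σ₀ p.2, p.1) := by
  rw [stripCell, if_neg h]

/-- A row without a full row strip is a matched row … [this file] -/
theorem mem_of_not_rowStrip (hfree : ∀ i ∈ D, (σ₀ i, i) ∉ T)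
    (hmax : ∀ σ : Equiv.Perm (Fin m), (free T σ).card ≤ D.card) {i' : Fin m}
    (h : ¬ ∀ j ∈ Dᶜ, (σ₀ i', j) ∈ T) : i' ∈ D := by
  by_contra hi'
  exact h fun j hj => mem_of_not_mem hfree hmax hi' (mem_compl.1 hj)

/-- … and then its column strip lies in `T`. [this file] -/
theorem colStrip_of_not_rowStrip (hfree : ∀ i ∈ D, (σ₀ i, i) ∉ T)
    (hmax : ∀ σ : Equiv.Perm (Fin m), (free T σ).card ≤ D.card) {i' : Fin m}
    (h : ¬ ∀ j ∈ Dᶜ, (σ₀ i', j) ∈ T) : ∀ j ∈ Dᶜ, (σ₀ j, i') ∈ T :=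
  (strip_or hfree hmax (mem_of_not_rowStrip hfree hmax h)).resolve_left h

/-- The witness cell of an outside column pair is a cell of `T` outside the square `σ₀(D) × D`. [this file] -/
theorem stripCell_mem (hfree : ∀ i ∈ D, (σ₀ i, i) ∉ T)
    (hmax : ∀ σ : Equiv.Perm (Fin m), (free T σ).card ≤ D.card) {p : Fin m × Fin m} (hp : p.2 ∉ D) :
    stripCell T σ₀ D p ∈ T.filter fun x => ¬ (σ₀.symm x.1 ∈ D ∧ x.2 ∈ D) := by
  rw [mem_filter]
  by_cases h : ∀ j ∈ Dᶜ, (σ₀ p.1, j) ∈ T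
  · rw [stripCell_of_pos h]
    exact ⟨h p.2 (mem_compl.2 hp), fun h' => hp h'.2⟩
  · rw [stripCell_of_neg h]
    exact ⟨colStrip_of_not_rowStrip hfree hmax h p.2 (mem_compl.2 hp), fun h' => hp (by simpa using h'.1)⟩

/-- The witness-cell map is injective on `univ × Dᶜ`. [this file] -/
theorem stripCell_injOn (hfree : ∀ i ∈ D, (σ₀ i, i) ∉ T)
    (hmax : ∀ σ : Equiv.Perm (Fin m), (free T σ).card ≤ D.card) {p q : Fin m × Fin m} (hp : p.2 ∉ D)
    (hq : q.2 ∉ D) (hpq : stripCell T σ₀ D p = stripCell T σ₀ D q) : p = q := by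
  by_cases h : ∀ j ∈ Dᶜ, (σ₀ p.1, j) ∈ T <;> by_cases h' : ∀ j ∈ Dᶜ, (σ₀ q.1, j) ∈ T
  · rw [stripCell_of_pos h, stripCell_of_pos h', Prod.mk.injEq] at hpq
    exact Prod.ext (σ₀.injective hpq.1) hpq.2
  · rw [stripCell_of_pos h, stripCell_of_neg h', Prod.mk.injEq] at hpq
    exact (hp (hpq.2 ▸ mem_of_not_rowStrip hfree hmax h')).elim
  · rw [stripCell_of_neg h, stripCell_of_pos h', Prod.mk.injEq] at hpq
    exact (hq (hpq.2 ▸ mem_of_not_rowStrip hfree hmax h)).elim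
  · rw [stripCell_of_neg h, stripCell_of_neg h', Prod.mk.injEq] at hpq
    exact Prod.ext hpq.2 (σ₀.injective hpq.1)

/-- **MAXIMALITY COUNT**: `T` has at least `m · |Dᶜ|` cells OUTSIDE the square `σ₀(D) × D`.
[cite: BrualdiRyser1991, Thm. 4.2.1] -/
theorem mul_card_compl_le (hfree : ∀ i ∈ D, (σ₀ i, i) ∉ T)
    (hmax : ∀ σ : Equiv.Perm (Fin m), (free T σ).card ≤ D.card) :
    m * Dᶜ.card ≤ (T.filter fun x => ¬ (σ₀.symm x.1 ∈ D ∧ x.2 ∈ D)).card := by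
  have h1 : m * Dᶜ.card = ((univ : Finset (Fin m)) ×ˢ Dᶜ).card := by
    rw [card_product, card_univ, Fintype.card_fin]
  rw [h1]
  refine card_le_card_of_injOn (stripCell T σ₀ D) (fun p hp => ?_) fun p hp q hq hpq => ?_
  · exact mem_coe.2 (stripCell_mem hfree hmax (mem_compl.1 (mem_product.1 (mem_coe.1 hp)).2))
  · exact stripCell_injOn hfree hmax (mem_compl.1 (mem_product.1 (mem_coe.1 hp)).2)
      (mem_compl.1 (mem_product.1 (mem_coe.1 hq)).2) hpq

/-! ## 3. The auxiliary pattern `T♯` -/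

/-- The AUXILIARY PATTERN `T♯` of `(T, σ₀, D)`: `T` on the columns of `D`, every off-`σ₀` cell on the other
columns. [this file] -/
def sharp (T : Finset (Fin m × Fin m)) (σ₀ : Equiv.Perm (Fin m)) (D : Finset (Fin m)) :
    Finset (Fin m × Fin m) :=
  univ.filter fun x => (x.2 ∈ D ∧ x ∈ T) ∨ (x.2 ∉ D ∧ σ₀ x.2 ≠ x.1)

/-- Membership in `T♯`. [this file] -/
theorem mem_sharp {x : Fin m × Fin m} :
    x ∈ sharp T σ₀ D ↔ (x.2 ∈ D ∧ x ∈ T) ∨ (x.2 ∉ D ∧ σ₀ x.2 ≠ x.1) := by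
  simp only [sharp, mem_filter, mem_univ, true_and]

/-- On a column of `D`, `T♯` is `T`. [this file] -/
theorem mk_mem_sharp_iff_of_mem {k i : Fin m} (hi : i ∈ D) : (k, i) ∈ sharp T σ₀ D ↔ (k, i) ∈ T := by
  rw [mem_sharp]
  exact ⟨fun h => h.elim (fun h => h.2) fun h => (h.1 hi).elim, fun h => Or.inl ⟨hi, h⟩⟩

/-- Off the columns of `D`, `T♯` is everything but the `σ₀`-cell. [this file] -/
theorem mk_mem_sharp_iff_of_not_mem {k i : Fin m} (hi : i ∉ D) :
    (k, i) ∈ sharp T σ₀ D ↔ σ₀ i ≠ k := by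
  rw [mem_sharp]
  exact ⟨fun h => h.elim (fun h => (hi h.1).elim) fun h => h.2, fun h => Or.inr ⟨hi, h⟩⟩

/-- The permutations avoiding `T♯`: `T`-free on `D` and equal to `σ₀` off `D`. [this file] -/
theorem mem_avoid_sharp {σ : Equiv.Perm (Fin m)} :
    σ ∈ avoid (sharp T σ₀ D) ↔ (∀ i ∈ D, (σ i, i) ∉ T) ∧ ∀ i, i ∉ D → σ i = σ₀ i := by
  rw [mem_avoid]
  constructor
  · intro h
    refine ⟨fun i hi hT => h i ((mk_mem_sharp_iff_of_mem hi).2 hT), fun i hi => ?_⟩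
    by_contra hne
    exact h i ((mk_mem_sharp_iff_of_not_mem hi).2 (Ne.symm hne))
  · rintro ⟨h1, h2⟩ i
    by_cases hi : i ∈ D
    · rw [mk_mem_sharp_iff_of_mem hi]
      exact h1 i hi
    · rw [mk_mem_sharp_iff_of_not_mem hi, h2 i hi]
      exact fun h => h rfl

/-- `σ₀` avoids `T♯` (as soon as it is `T`-free on `D`). [this file] -/
theorem self_mem_avoid_sharp (hfree : ∀ i ∈ D, (σ₀ i, i) ∉ T) : σ₀ ∈ avoid (sharp T σ₀ D) :=
  mem_avoid_sharp.2 ⟨hfree, fun _ _ => rfl⟩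

/-! ## 4. The quadratic count on the square -/

/-- **THE QUADRATIC COUNT ON THE SQUARE**: if every block of `T♯` through a square row has at most `c` rows,
`|D|² ≤ 2·|T ∩ (σ₀(D) × D)| + c·|D|` — the ordered pairs `(i, i') ∈ D × D` with UNLINKED rows `σ₀ i, σ₀ i'`
inject twice into `T ∩ square` by `(i, i') ↦ (σ₀ i, i')`, `(σ₀ i', i)` (two-cycle exclusion for `T♯`,
`rect_subset_or`), the linked ones number at most `c` per row. [cite: BrualdiRyser1991, Thm. 4.2.6] -/
theorem sq_le_of_card_rowBlock_le (hfree : ∀ i ∈ D, (σ₀ i, i) ∉ T) {c : ℕ}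
    (hc : ∀ i ∈ D, (rowBlock (sharp T σ₀ D) (σ₀ i)).card ≤ c) :
    D.card * D.card ≤ 2 * (T.filter fun x => σ₀.symm x.1 ∈ D ∧ x.2 ∈ D).card + c * D.card := by
  have hσ₀ := self_mem_avoid_sharp hfree
  have hLU : ((D ×ˢ D).filter fun p => σ₀ p.2 ∈ rowBlock (sharp T σ₀ D) (σ₀ p.1)).card +
      ((D ×ˢ D).filter fun p => σ₀ p.2 ∉ rowBlock (sharp T σ₀ D) (σ₀ p.1)).card = D.card * D.card := by
    rw [card_filter_add_card_filter_not, card_product]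
  -- linked pairs: at most `c` per row
  have hL : ((D ×ˢ D).filter fun p => σ₀ p.2 ∈ rowBlock (sharp T σ₀ D) (σ₀ p.1)).card ≤ c * D.card := by
    calc ((D ×ˢ D).filter fun p => σ₀ p.2 ∈ rowBlock (sharp T σ₀ D) (σ₀ p.1)).card
        ≤ (D.biUnion fun i => (rowBlock (sharp T σ₀ D) (σ₀ i)).image fun k => (i, σ₀.symm k)).card :=
          card_le_card fun p hp => by
            obtain ⟨hpD, hl⟩ := mem_filter.1 hp
            rw [mem_biUnion]
            exact ⟨p.1, (mem_product.1 hpD).1, mem_image.2 ⟨σ₀ p.2, hl, by simp⟩⟩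
      _ ≤ ∑ i ∈ D, ((rowBlock (sharp T σ₀ D) (σ₀ i)).image fun k => (i, σ₀.symm k)).card :=
          card_biUnion_le
      _ ≤ ∑ i ∈ D, c := sum_le_sum fun i hi => card_image_le.trans (hc i hi)
      _ = c * D.card := by rw [sum_const, smul_eq_mul, mul_comm]
  -- unlinked pairs: two injections into `T ∩ square`
  have hφ : Function.Injective fun p : Fin m × Fin m => (σ₀ p.1, p.2) := by
    rintro ⟨p₁, p₂⟩ ⟨q₁, q₂⟩ h
    simp only [Prod.mk.injEq, EmbeddingLike.apply_eq_iff_eq] at h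
    rw [h.1, h.2]
  have hψ : Function.Injective fun p : Fin m × Fin m => (σ₀ p.2, p.1) := by
    rintro ⟨p₁, p₂⟩ ⟨q₁, q₂⟩ h
    simp only [Prod.mk.injEq, EmbeddingLike.apply_eq_iff_eq] at h
    rw [h.1, h.2]
  have hcover : ((D ×ˢ D).filter fun p => σ₀ p.2 ∉ rowBlock (sharp T σ₀ D) (σ₀ p.1)) ⊆
      ((D ×ˢ D).filter fun p => (σ₀ p.1, p.2) ∈ T) ∪ ((D ×ˢ D).filter fun p => (σ₀ p.2, p.1) ∈ T) := by
    intro p hp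
    obtain ⟨hpD, hna⟩ := mem_filter.1 hp
    obtain ⟨h1D, h2D⟩ := mem_product.1 hpD
    rw [mem_union, mem_filter, mem_filter]
    rcases rect_subset_or ⟨σ₀, hσ₀⟩ hna with h | h
    · exact Or.inl ⟨hpD, (mk_mem_sharp_iff_of_mem h2D).1 (h (mem_product.2
        ⟨self_mem_rowBlock _ _, (mem_colBlock_iff_apply_mem_rowBlock hσ₀).2 (self_mem_rowBlock _ _)⟩))⟩
    · exact Or.inr ⟨hpD, (mk_mem_sharp_iff_of_mem h1D).1 (h (mem_product.2
        ⟨self_mem_rowBlock _ _, (mem_colBlock_iff_apply_mem_rowBlock hσ₀).2 (self_mem_rowBlock _ _)⟩))⟩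
  have h1 : ((D ×ˢ D).filter fun p => (σ₀ p.1, p.2) ∈ T).card ≤
      (T.filter fun x => σ₀.symm x.1 ∈ D ∧ x.2 ∈ D).card := by
    rw [← card_image_of_injective ((D ×ˢ D).filter fun p => (σ₀ p.1, p.2) ∈ T) hφ]
    refine card_le_card fun x hx => ?_
    obtain ⟨p, hp, rfl⟩ := mem_image.1 hx
    obtain ⟨hpD, hpT⟩ := mem_filter.1 hp
    obtain ⟨h1D, h2D⟩ := mem_product.1 hpD
    exact mem_filter.2 ⟨hpT, by simpa using h1D, h2D⟩
  have h2 : ((D ×ˢ D).filter fun p => (σ₀ p.2, p.1) ∈ T).card ≤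
      (T.filter fun x => σ₀.symm x.1 ∈ D ∧ x.2 ∈ D).card := by
    rw [← card_image_of_injective ((D ×ˢ D).filter fun p => (σ₀ p.2, p.1) ∈ T) hψ]
    refine card_le_card fun x hx => ?_
    obtain ⟨p, hp, rfl⟩ := mem_image.1 hx
    obtain ⟨hpD, hpT⟩ := mem_filter.1 hp
    obtain ⟨h1D, h2D⟩ := mem_product.1 hpD
    exact mem_filter.2 ⟨hpT, by simpa using h2D, h1D⟩
  have hU := (card_le_card hcover).trans (card_union_le _ _)
  omega

/-- An algebraic identity for the final count. [this file] -/
theorem sq_eq_of_add_eq {r d n : ℕ} (h : r + d = n) : n * n = r * r + r * d + n * d := by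
  subst h; ring

/-- **THE SQUARE COUNT.** For a maximum `T`-free pair `(σ₀, D)` all of whose square blocks of `T♯` have at most
`c` rows, `m² ≤ 2·|T| + c·|D|`: the square contributes `|D|² ≤ 2·|T ∩ square| + c·|D|`, maximality
contributes `m·|Dᶜ| ≤ |T ∖ square|`, and `m² = |D|² + |D|·|Dᶜ| + m·|Dᶜ|`. [this file] -/
theorem sq_le_of_maxFree (hfree : ∀ i ∈ D, (σ₀ i, i) ∉ T)
    (hmax : ∀ σ : Equiv.Perm (Fin m), (free T σ).card ≤ D.card) {c : ℕ}
    (hc : ∀ i ∈ D, (rowBlock (sharp T σ₀ D) (σ₀ i)).card ≤ c) : m * m ≤ 2 * T.card + c * D.card := by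
  have h1 := sq_le_of_card_rowBlock_le hfree hc
  have h2 := mul_card_compl_le hfree hmax
  have h3 : (T.filter fun x => σ₀.symm x.1 ∈ D ∧ x.2 ∈ D).card +
      (T.filter fun x => ¬ (σ₀.symm x.1 ∈ D ∧ x.2 ∈ D)).card = T.card :=
    card_filter_add_card_filter_not _
  have h4 : D.card + Dᶜ.card = m := by rw [card_add_card_compl, Fintype.card_fin]
  have h5 := sq_eq_of_add_eq h4
  have h6 : D.card * Dᶜ.card ≤ m * Dᶜ.card := Nat.mul_le_mul_right _ (by omega)
  omega

end

end Summit.ValiantsHypothesis.ValiantsHypothesis.Theorems.DefinabilityGapMatchingSquare
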